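import Literature.Combinatorics.SimpleGraph.BrinkmannTuckerVanCleemput2021.SearchData
import HarnessLib

/-!
# Class-2 certificate for `G70`: kernel evaluation of block `C`'s interface table

`tabC_spec`: for every `i < 81`, bit `i` of `tabC` equals the answer of the search
`run (fun _ => true) progC (dec i)` of `…SearchData` (same directory) — i.e. the table
records exactly the cut colourings (base-3 code `i`) from which block `C`'s exhaustive
search finds a branch passing all comparisons.  Evaluated by the Lean KERNEL (`decide +kernel`,
≈ 30 s; no `native_decide`, standard axioms only); one module per block so that each elaborates
quickly.
Only the direction "search rejects ⇒ bit clear" is used downstream (`…ClassTwo`).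

Provenance: refutations bundle `papers/_cross/refutations` (H21 seat pub-refute-2, 2026-08-18);
the programs and tables were GENERATED by that seat's `g16/gen_data.py` (pure Python; it also
re-runs the three searches) from the rotation table of `…BrinkmannTuckerVanCleemput2021.G70`;
written for the tree under the Lean-in-tree rule (human 2026-08-18).
-/

namespace Literature.Combinatorics.SimpleGraph.BrinkmannTuckerVanCleemput2021

/-- Kernel fact: `tabC` is block `C`'s acceptance table on all `81` cut colourings. [folklore] -/
theorem tabC_spec :
    (List.range 81).all
      (fun i => Nat.testBit tabC i == run (fun _ => true) progC (dec i)) = true := by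
  decide +kernel

end Literature.Combinatorics.SimpleGraph.BrinkmannTuckerVanCleemput2021
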